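import Summits.QuantumFields.BalabanUV.T4Continuum.Support.ScalarAveragedCompression
import Summits.QuantumFields.BalabanUV.T4Continuum.Support.GaugeTermCoercivity
import Summits.QuantumFields.BalabanUV.T4Continuum.Support.KroneckerLift

/-!
# T⁴ programme, spine node NE2 (U1a), tier B support row B4.c, file 6 — THE `U = 1` SCALAR LAYER IN ROW B4.b's VOCABULARY:
# `DeltaPs = ∂ᴴ∂ + a′•Π′` (Gram + positive mass), `Coercive γ′ DeltaPs`, and the colour lifts `⊗ₖ 1`

NE2 formalisation swarm `b2b-balaban-t4-ne2-formalise-*`, leaf 09 (support row B4.c).  Row B4.b's coercivity transfer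
`GaugeTermCoercivity.coercive_gram_perturb` (leaf-05, p209121) takes the free scalar operator in the form `S₁ = Dtᴴ·Dt + Y₁` with
`Y₁ ⪰ 0` and `Coercive γ′ S₁` (`Spine/CoerciveInverseTower.Coercive`); row B4.c proved coercivity of `DeltaPs n M a′ = LapS + a′•PiS` in
its own words (`ScalarAveragedPropagator.coercive`, `re_form_DeltaPs_ge`).  This small file states the `U = 1` inputs LITERALLY in B4.b's
shapes so the wiring file has nothing to re-derive:
 * `DeltaPs_eq_gram : DeltaPs n M a′ = (GradOp)ᴴ * GradOp + (a′:ℂ) • PiS n M` (`B5Action121.GradOp_conjTranspose_mul_GradOp`);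
 * `PiS_posSemidef`, `smul_PiS_posSemidef (0 ≤ a′)` (from `form_PiS : ⟨f, Π′f⟩ = nsq (Π′f)`), and their colour lifts `…_kron`;
 * **`coercive_DeltaPs (ha′) : Coercive (gammaPs d a′) (DeltaPs n M a′)`** (= `re_form_DeltaPs_ge`, same sentence) and
   **`coercive_DeltaPs_kron : Coercive (gammaPs d a′) (DeltaPs n M a′ ⊗ₖ (1 : Matrix o o ℂ))`** (`GaugeTermCoercivity.coercive_kron_one`);
 * `DeltaPs_kron_eq_gram : DeltaPs ⊗ₖ 1 = (GradOp ⊗ₖ 1)ᴴ * (GradOp ⊗ₖ 1) + (a′:ℂ) • (PiS ⊗ₖ 1)` — the `hS₁` of `coercive_gram_perturb` on colour 0-forms.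

HONEST FRAMING (T4-DAG p. 1).  [folklore] bookkeeping; `U = 1`, FIXED FINITE torus, scalar layer; support glue for row B4.b; NE2 NOT proved; spine 0/9
unchanged; NOT infinite volume / mass gap / Clay / summit progress.  HONEST DEPENDENCY: continuum YM on T⁴ ⇐ BetaPertH ∧ nine spine estimates
(0/9 proved); BetaPertH ⇐ (D1) ∧ (D4) ∧ CAP+tail; G-an2-4 gates asym, D1 and NE2/3/4.  ABSOLUTE RULE kept; zero sorries.
-/

noncomputable section

open scoped BigOperators ComplexConjugate ComplexOrder Matrix Matrix.Norms.L2Operator Kronecker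

namespace Summit.QuantumFields.BalabanUV.T4Continuum.ScalarLayerFreeInputs

open Literature.MathematicalPhysics.QuantumFieldTheory.Balaban1983to89.B5Prop11Plancherel
open Literature.MathematicalPhysics.QuantumFieldTheory.Balaban1983to89.B5Prop11Lower (nsq nsq_nonneg)
open Literature.MathematicalPhysics.QuantumFieldTheory.Balaban1983to89.B5Action121 (LapS GradOp GradOp_conjTranspose_mul_GradOp)
open Summit.QuantumFields.BalabanUV.T4Continuum.CoerciveInverseTower (Coercive)
open Summit.QuantumFields.BalabanUV.T4Continuum.GaugeTermCoercivity (coercive_kron_one)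
open Summit.QuantumFields.BalabanUV.T4Continuum.KroneckerLift
open Summit.QuantumFields.BalabanUV.T4Continuum.ScalarBlockPoincare
open Summit.QuantumFields.BalabanUV.T4Continuum.ScalarAveragedPropagator

variable {d : ℕ} (n : ℕ) [NeZero n] (M : Fin d → ℕ) [hM : ∀ μ, NeZero (M μ)] (a' : ℝ)

/-- `DeltaPs = ∂ᴴ∂ + a′•Π′` — the Gram-plus-mass form (`S₁ = Dtᴴ Dt + Y₁` of `GaugeTermCoercivity.coercive_gram_perturb`). [folklore] -/
theorem DeltaPs_eq_gram :
    DeltaPs n M a' = (GradOp (fine n M) (n : ℂ))ᴴ * GradOp (fine n M) (n : ℂ) + (a' : ℂ) • PiS n M := by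
  rw [DeltaPs, GradOp_conjTranspose_mul_GradOp]

/-- `Π′ ⪰ 0` (`⟨f, Π′f⟩ = nsq (Π′f)`). [folklore] -/
theorem PiS_posSemidef : (PiS n M).PosSemidef := by
  refine Matrix.PosSemidef.of_dotProduct_mulVec_nonneg (PiS_isHermitian n M) fun f => ?_
  rw [form_PiS, Complex.zero_le_real]
  exact nsq_nonneg _

/-- `a′•Π′ ⪰ 0` for `a′ ≥ 0` (the `Y₁` of `coercive_gram_perturb`). [folklore] -/
theorem smul_PiS_posSemidef (ha : 0 ≤ a') : ((a' : ℂ) • PiS n M).PosSemidef := by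
  refine Matrix.PosSemidef.of_dotProduct_mulVec_nonneg ((PiS_isHermitian n M).smul (by simp [IsSelfAdjoint, Complex.conj_ofReal])) fun f => ?_
  rw [Matrix.smul_mulVec, dotProduct_smul, smul_eq_mul, form_PiS, ← Complex.ofReal_mul, Complex.zero_le_real]
  exact mul_nonneg ha (nsq_nonneg _)

variable {a'}

/-- **`Coercive γ′ DeltaPs`** in `CoerciveInverseTower`'s vocabulary (the same sentence as `re_form_DeltaPs_ge`). [folklore] -/
theorem coercive_DeltaPs (ha' : 0 < a') : Coercive (gammaPs d a') (DeltaPs n M a') :=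
  fun f => re_form_DeltaPs_ge n M ha' f

/-! ### Colour lifts -/

variable (o : Type*) [Fintype o] [DecidableEq o] (a')

/-- `DeltaPs ⊗ 1 = (∂ ⊗ 1)ᴴ(∂ ⊗ 1) + a′•(Π′ ⊗ 1)` on colour 0-forms. [folklore] -/
theorem DeltaPs_kron_eq_gram :
    DeltaPs n M a' ⊗ₖ (1 : Matrix o o ℂ)
      = (GradOp (fine n M) (n : ℂ) ⊗ₖ (1 : Matrix o o ℂ))ᴴ * (GradOp (fine n M) (n : ℂ) ⊗ₖ (1 : Matrix o o ℂ))
        + (a' : ℂ) • (PiS n M ⊗ₖ (1 : Matrix o o ℂ)) := by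
  rw [DeltaPs_eq_gram, Matrix.add_kronecker, Matrix.smul_kronecker, kron_mul, kron_conjTranspose]

/-- `Π′ ⊗ 1 ⪰ 0`. [folklore] -/
theorem PiS_kron_posSemidef : (PiS n M ⊗ₖ (1 : Matrix o o ℂ)).PosSemidef := by
  have h1 : (1 : Matrix o o ℂ).PosSemidef := Matrix.PosSemidef.one
  exact (PiS_posSemidef n M).kronecker h1

/-- `a′•(Π′ ⊗ 1) ⪰ 0` for `a′ ≥ 0`. [folklore] -/
theorem smul_PiS_kron_posSemidef (ha : 0 ≤ a') : ((a' : ℂ) • (PiS n M ⊗ₖ (1 : Matrix o o ℂ))).PosSemidef := by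
  rw [← Matrix.smul_kronecker]
  exact (smul_PiS_posSemidef n M a' ha).kronecker Matrix.PosSemidef.one

variable {a'}

/-- **`Coercive γ′ (DeltaPs ⊗ 1)`** on colour 0-forms. [folklore] -/
theorem coercive_DeltaPs_kron (ha' : 0 < a') : Coercive (gammaPs d a') (DeltaPs n M a' ⊗ₖ (1 : Matrix o o ℂ)) :=
  coercive_kron_one (coercive_DeltaPs n M ha')

/-- the free inverse bound on colour 0-forms: `‖(DeltaPs ⊗ 1)⁻¹‖ ≤ γ′⁻¹`. [folklore] -/
theorem opNorm_inv_DeltaPs_kron_le (ha' : 0 < a') : ‖(DeltaPs n M a' ⊗ₖ (1 : Matrix o o ℂ))⁻¹‖ ≤ (gammaPs d a')⁻¹ := by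
  rw [kron_inv]; exact opNorm_kron_le_of_le _ (opNorm_Gps_le n M ha')

end Summit.QuantumFields.BalabanUV.T4Continuum.ScalarLayerFreeInputs

end
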